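import Summits.CriticalPhenomena.PercolationContinuityZ3.Theorems.PercRayRenewalAssembly
import Summits.CriticalPhenomena.PercolationContinuityZ3.Theorems.PercRayRenewalJumpLineAvoidanceDecayEquivalences
import HarnessLib

/-!
# Route `PercRayRenewal`, crux G (`JumpLineAvoidanceDecay`, stmt-CriticalPhenomena-4626):
# modulo the route's other crux T2, the crux IS the sub-problem

Structural facts for the planners (lead c4 of the crux chain, 2026-08-17), all kernel-checked:

* `jumpLineAvoidanceDecay_of_percolationContinuityZ3` — the sub-problem statement
  `θ(p_c(ℤ³)) = 0` gives the crux G outright (its hypothesis `0 < θ(p_c)` becomes absurd: G is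
  a statement about the counterfactual "jump world");
* `jumpTruncatedOneArmDecay_of_percolationContinuityZ3` — likewise for G1′
  (`JumpTruncatedOneArmDecay`, stmt-CriticalPhenomena-4627);
* `jumpLineAvoidanceDecay_iff_percolationContinuityZ3` — **given the unconditional crux T2
  (`TwoArmsRatioExponent`, stmt-CriticalPhenomena-4625), G is EQUIVALENT to `θ(p_c(ℤ³)) = 0`**:
  `→` is the proved Assembly of the route (`percRayRenewalAssembly_proof`, stmt-4630), `←` is
  vacuity. So, once T2 is in hand, a proof of G is literally a proof of the sub-problem, and G
  cannot be cheaper than "`θ(p_c) = 0` minus T2"; with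
  `jumpLineAvoidanceDecay_iff_jumpTruncatedOneArmDecay` (p148031) the same holds for G1′
  (`jumpTruncatedOneArmDecay_iff_percolationContinuityZ3`).

These are bookkeeping theorems (no percolation estimate is proved here); they record in the tree
why four line leads found no same-`p` mechanism for G short of the conjecture itself.
-/

noncomputable section

namespace Summit.CriticalPhenomena.PercolationContinuityZ3.Theorems

open Literature.Probability.Percolation Literature.Probability.LatticeModels

/-- **Vacuity: `θ(p_c(ℤ³)) = 0` implies the crux G.** If the percolation probability vanishes at
`p_c`, the hypothesis `0 < θ(p_c)` of `JumpLineAvoidanceDecay` is contradictory, so the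
implication holds. [folklore] -/
theorem jumpLineAvoidanceDecay_of_percolationContinuityZ3 :
    _root_.PercolationContinuityZ3 → Theses.PercRayRenewal.JumpLineAvoidanceDecay := by
  unfold Theses.PercRayRenewal.JumpLineAvoidanceDecay
  intro h hjump
  have h0 : theta (zdGraph 3) (0 : Site 3) (criticalProbI 3) = 0 := h
  exact absurd h0 (ne_of_gt hjump)

/-- **Vacuity: `θ(p_c(ℤ³)) = 0` implies the crux G1′** (`JumpTruncatedOneArmDecay`), for the same
reason. [folklore] -/
theorem jumpTruncatedOneArmDecay_of_percolationContinuityZ3 :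
    _root_.PercolationContinuityZ3 → Theses.PercRayRenewal.JumpTruncatedOneArmDecay := by
  unfold Theses.PercRayRenewal.JumpTruncatedOneArmDecay
  intro h hjump
  have h0 : theta (zdGraph 3) (0 : Site 3) (criticalProbI 3) = 0 := h
  exact absurd h0 (ne_of_gt hjump)

/-- **Modulo T2, the crux G is the sub-problem.** Assuming the two-arms ratio law
`TwoArmsRatioExponent` (the route's unconditional crux), `JumpLineAvoidanceDecay` holds if and
only if `θ(p_c(ℤ³)) = 0`: the forward direction is the route's proved Assembly
(`percRayRenewalAssembly_proof`), the converse is vacuity. [folklore] -/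
theorem jumpLineAvoidanceDecay_iff_percolationContinuityZ3
    (hT2 : Summit.CriticalPhenomena.PercolationContinuityZ3.Theses.PercRayRenewal.TwoArmsRatioExponent) :
    Summit.CriticalPhenomena.PercolationContinuityZ3.Theses.PercRayRenewal.JumpLineAvoidanceDecay ↔
      _root_.PercolationContinuityZ3 :=
  ⟨fun hG => percRayRenewalAssembly_proof hT2 hG,
    jumpLineAvoidanceDecay_of_percolationContinuityZ3⟩

/-- **Modulo T2, the crux G1′ is the sub-problem too** (through the landed equivalence
`jumpLineAvoidanceDecay_iff_jumpTruncatedOneArmDecay`, p148031). [folklore] -/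
theorem jumpTruncatedOneArmDecay_iff_percolationContinuityZ3
    (hT2 : Theses.PercRayRenewal.TwoArmsRatioExponent) :
    Theses.PercRayRenewal.JumpTruncatedOneArmDecay ↔ _root_.PercolationContinuityZ3 :=
  jumpLineAvoidanceDecay_iff_jumpTruncatedOneArmDecay.symm.trans
    (jumpLineAvoidanceDecay_iff_percolationContinuityZ3 hT2)

end Summit.CriticalPhenomena.PercolationContinuityZ3.Theorems

end
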